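import Literature.MathematicalPhysics.QuantumFieldTheory.Balaban1983to89.B14Eq363SummedKernel

/-!
# `Balaban1983to89.B14Eq362Marginals` — T. Bałaban, *Convergent renormalization expansions for lattice gauge theories*,
# Commun. Math. Phys. **119** (1988) 243–285 [Balaban1988Convergent]: the step *"Using … the identity (I.4.15) again"*
# of (3.62) p. 282 — the MARGINAL identities `Σ_y Π^{(j)}_{μν}(x, y, 0) = 0 = Σ_x Π^{(j)}_{μν}(x, y, 0)` PROVED on the
# infinite lattice from the second-order Ward–Takahashi identity (I.4.15) for gauge functions of FINITE support and the
# decay (3.48), by the linear gauge function of (I.4.23) truncated to boxes (Tannery's dominated convergence)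

statement-level skeleton of published theorems with citation tags; proofs where landed; nothing here is a claim about the Yang–Mills mass gap

PDF held: `paper:balaban1988-cmp119-convergent-renormalization` (journal page = PDF page + 242); p. 282 [PDF 40] read from the
OCR text layer and the x2 render `…-p040-x2.png` of the cell `pub-balaban`; [I] pp. 284, 286 [PDF 36, 38] quoted from the typed
rows `B12Ward414` (cell reading of the renders `1987-cmp109-rg-I-small-field-p036-x2.png`, `-p038`).

CITATION HEADER (lean-in-tree rule).  WHAT IS REPRODUCED, verbatim.  [Balaban1988Convergent] p. 282: *"Using the translation
invariance and the identity (I.4.15) again we have β′_j = Σ_{x,y}Π^{(j)}_{22}(x, y, 0)x₁y₁ = −½Σ_{x,y}Π^{(j)}_{22}(x, y, 0)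
(x₁ − y₁)² = … (3.62)"*.  [Balaban1987RG1] p. 284, (4.15), first identity: *"⟨(δ²/δB²)𝐄(1), B₁, ∂λ⟩ = 0 … for an arbitrary
gauge function λ, and arbitrary gauge fields B₁, B₂, B₃"*; p. 286, (4.23): *"B_{μ₃}(x) = (∂_{μ₃}λ_x)(x₃), λ_x(x₃) =
Σ_{ν=1}^{4}(x_{3,ν} − x_ν)B_ν(x)"* (a LINEAR gauge function).  SKELETON row **B14.Eq3.62–3.64** (owner r11): the first
equality of (3.62) is `B14.Eq364Beta.eq362a`, which takes the two marginal identities as HYPOTHESES `hWx`, `hWy` (*"the print's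
«(I.4.15) again», hypotheses, as in `B14Sect3.beta_resum_362`"*); the same hypotheses enter `B14.Eq364Beta.eq364`,
`B14.Eq363SummedKernel.eq364_summed` and `B14.Eq360TensorInvariance.P4_refl`.  THIS FILE discharges them to (I.4.15).

THE ARGUMENT.  With `B₁ = δ_{(μ,x)}` the identity (I.4.15)₁ reads, in kernel form on the whole lattice `L^{−j}Z^d` (the three-point
kernel `Π_{μν}(x, y, z)` of p. 281 at `z = 0`, abstract `P3` as in `B14Eq364Beta`), `Σ_y Σ_ν Π_{μν}(x, y, 0)(∂_νλ)(y) = 0` for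
every gauge function `λ` of finite support (`hWT`; `(∂_νλ)(y) = λ(y + e_ν) − λ(y)`, `grad`).  The linear gauge function `λ(y) =
y_κ` of (I.4.23) has `∂_νλ ≡ δ_{νκ}` and would give the marginal identity at once, but it is not of finite support; truncated to
the box `|y_j| ≤ R` (`lamBox`) its gradient converges pointwise to `δ_{νκ}` (`grad_lamBox_eventually`) and is dominated by
`3·Π_j(|y_j| + 1)` (`abs_grad_lamBox_le`), so by the decay (3.48) (`Decay3`) and Tannery's theorem the identities for `λ_R` pass
to the limit: `Σ_y Π_{μκ}(x, y, 0) = 0` (`marginal_y_eq_zero`).  The `x`-marginal follows from (I.4.15)₁ with the roles of the two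
slots exchanged (`marginal_x_eq_zero`; for a symmetric second-derivative kernel this is the same identity,
`marginal_x_eq_zero_of_symm`).  Consequence: `eq364_of_WT` — the (3.61)–(3.64) chain `β′_j = β` with the marginal hypotheses
replaced by (I.4.15)₁.  Nothing is asserted about [I]'s functionals; (I.4.15) itself is B12's row (`B12Ward414.ward_second_order`
proves its abstract form from gauge invariance).

Mega-formalization `lit-balaban`, unit `lit-balaban-r11` gen 4 (B14 fold owner), HOME `run/shared/lean/pub/lit-balaban/`.

## References
* [Balaban1988Convergent] T. Bałaban, Commun. Math. Phys. 119 (1988) 243–285, (3.48) p.280, (3.62) p.282.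
* [Balaban1987RG1] T. Bałaban, Commun. Math. Phys. 109 (1987) 249–301 ([I]: (4.15) p.284, (4.23) p.286).
-/

namespace Literature.MathematicalPhysics.QuantumFieldTheory.Balaban1983to89.B14.Eq362Marginals

open _root_.Filter _root_.Topology Finset
open Literature.MathematicalPhysics.QuantumFieldTheory.GawedzkiKupiainen1985.PeriodicGleason
open Literature.MathematicalPhysics.QuantumFieldTheory.Balaban1983to89
open Literature.MathematicalPhysics.QuantumFieldTheory.Balaban1983to89.B14.Eq364Beta
open Literature.MathematicalPhysics.QuantumFieldTheory.Balaban1983to89.B14.Eq363SummedKernel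

variable {d : ℕ}

/-! ## §1. Gauge functions: lattice gradient, the truncated linear gauge function of (I.4.23) -/

/-- The lattice gradient of a gauge function: `(∂_νλ)(y) = λ(y + e_ν) − λ(y)`. [cite: Balaban1987RG1, (4.9) p.283] -/
def grad (lam : Pt d → ℝ) (ν : Fin d) (y : Pt d) : ℝ := lam (y + unitVec ν) - lam y

/-- The linear gauge function `λ(y) = y_κ` of (I.4.23), truncated to the box `{y : |y_j| ≤ R ∀ j}` (zero outside), so that it
has finite support. [cite: Balaban1987RG1, (4.23) p.286] -/
def lamBox (κ : Fin d) (R : ℕ) (y : Pt d) : ℝ := if (∀ j, |y j| ≤ (R : ℤ)) then (y κ : ℝ) else 0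

/-- The truncated gauge function has finite support (inside the box). [cite: Balaban1987RG1, (4.23) p.286] -/
theorem lamBox_support_finite (κ : Fin d) (R : ℕ) : (Function.support (lamBox κ R)).Finite := by
  refine (Set.Finite.pi (ι := Fin d) (t := fun _ : Fin d => Set.Icc (-(R : ℤ)) R)
    (fun _ => Set.finite_Icc _ _)).subset ?_
  intro y hy
  rw [Function.mem_support] at hy
  unfold lamBox at hy
  by_cases hb : ∀ j, |y j| ≤ (R : ℤ)
  · exact Set.mem_univ_pi.2 fun j => Set.mem_Icc.2 (abs_le.1 (hb j))
  · exact absurd (if_neg hb) hy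

/-- `|λ_R(y)| ≤ |y_κ|`. [folklore] -/
private theorem abs_lamBox_le (κ : Fin d) (R : ℕ) (y : Pt d) : |lamBox κ R y| ≤ |(y κ : ℝ)| := by
  unfold lamBox
  split_ifs
  · exact le_rfl
  · rw [abs_zero]; exact abs_nonneg _

/-- `1 ≤ Π_{j∈t} f j` for real factors `≥ 1`. [folklore] -/
private theorem one_le_prod_real {ι : Type*} (t : Finset ι) (f : ι → ℝ) (hf : ∀ j ∈ t, 1 ≤ f j) :
    1 ≤ ∏ j ∈ t, f j := by
  calc (1:ℝ) = ∏ _j ∈ t, (1:ℝ) := Finset.prod_const_one.symm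
    _ ≤ ∏ j ∈ t, f j := Finset.prod_le_prod (fun _ _ => zero_le_one) hf

/-- `|y_κ| + 1 ≤ pw 1 y`. [folklore] -/
private theorem abs_coord_add_one_le_pw (y : Pt d) (κ : Fin d) : |(y κ : ℝ)| + 1 ≤ pw 1 y := by
  classical
  unfold pw
  rw [← Finset.mul_prod_erase Finset.univ (fun j => (|(y j : ℝ)| + 1) ^ 1) (Finset.mem_univ κ)]
  have h1 := one_le_prod_real (Finset.univ.erase κ) (fun j => (|(y j : ℝ)| + 1) ^ 1)
    (fun j _ => by rw [pow_one]; linarith [abs_nonneg (y j : ℝ)])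
  rw [pow_one]
  nlinarith [abs_nonneg (y κ : ℝ)]

/-- Domination: `|(∂_νλ_R)(y)| ≤ 3·Π_j(|y_j| + 1)` uniformly in `R`. [cite: Balaban1987RG1, (4.23) p.286] -/
theorem abs_grad_lamBox_le (κ ν : Fin d) (R : ℕ) (y : Pt d) : |grad (lamBox κ R) ν y| ≤ 3 * pw 1 y := by
  unfold grad
  have h1 := abs_lamBox_le κ R (y + unitVec ν)
  have h2 := abs_lamBox_le κ R y
  have h3 : |(((y + unitVec ν) κ : ℤ) : ℝ)| ≤ |(y κ : ℝ)| + 1 := by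
    simp only [Pi.add_apply, unitVec, Int.cast_add]
    split_ifs
    · push_cast
      exact (abs_add_le _ _).trans (by rw [abs_one])
    · push_cast
      rw [add_zero]
      linarith [abs_nonneg (y κ : ℝ)]
  have h4 := abs_coord_add_one_le_pw y κ
  calc |lamBox κ R (y + unitVec ν) - lamBox κ R y|
      ≤ |lamBox κ R (y + unitVec ν)| + |lamBox κ R y| := abs_sub _ _
    _ ≤ (|(y κ : ℝ)| + 1) + |(y κ : ℝ)| := add_le_add (h1.trans h3) h2
    _ ≤ 3 * pw 1 y := by linarith [abs_nonneg (y κ : ℝ)]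

/-- Pointwise limit: for every fixed `y`, `(∂_νλ_R)(y) = δ_{νκ}` as soon as the box contains `y` and `y + e_ν` — the gradient of
the linear gauge function of (I.4.23). [cite: Balaban1987RG1, (4.23) p.286] -/
theorem grad_lamBox_eventually (κ ν : Fin d) (y : Pt d) :
    ∀ᶠ R : ℕ in atTop, grad (lamBox κ R) ν y = if ν = κ then 1 else 0 := by
  refine Filter.eventually_atTop.2 ⟨∑ j, (y j).natAbs + 1, fun R hR => ?_⟩
  have hyj : ∀ j, |y j| ≤ ((∑ j, (y j).natAbs : ℕ) : ℤ) := by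
    intro j
    rw [Int.abs_eq_natAbs]
    exact_mod_cast Finset.single_le_sum (fun i _ => Nat.zero_le ((y i).natAbs)) (Finset.mem_univ j)
  have hR' : ((∑ j, (y j).natAbs : ℕ) : ℤ) + 1 ≤ (R : ℤ) := by exact_mod_cast hR
  have hin1 : ∀ j, |y j| ≤ (R : ℤ) := fun j => by linarith [hyj j]
  have hin2 : ∀ j, |(y + unitVec ν) j| ≤ (R : ℤ) := by
    intro j
    simp only [Pi.add_apply, unitVec]
    split_ifs
    · exact (abs_add_le _ _).trans (by rw [abs_one]; linarith [hyj j])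
    · rw [add_zero]; exact hin1 j
  unfold grad lamBox
  rw [if_pos hin2, if_pos hin1]
  simp only [Pi.add_apply, unitVec, Int.cast_add]
  by_cases h : ν = κ
  · subst h; simp
  · have : ¬ (κ = ν) := fun h' => h h'.symm
    simp [this, h]

/-! ## §2. The marginal identities from (I.4.15)₁ -/

variable {P3 : Fin d → Fin d → Pt d → Pt d → Pt d → ℝ} {C κ : ℝ}

/-- **The `y`-marginal identity** used in (3.62): if the three-point kernel at `z = 0` satisfies the second-order Ward–Takahashi
identity (I.4.15)₁ `⟨(δ²/δB²)𝐄(1), δ_{(μ,x)}, ∂λ⟩ = Σ_y Σ_ν Π_{μν}(x, y, 0)(∂_νλ)(y) = 0` for every gauge function `λ` of finite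
support, and decays as (3.48), then `Σ_y Π_{μκ}(x, y, 0) = 0` for all `μ, κ, x`.
[cite: Balaban1988Convergent, (3.62) p.282] -/
theorem marginal_y_eq_zero (hD : Decay3 P3 C κ) (hκ : 0 < κ)
    (hWT : ∀ (μ : Fin d) (x : Pt d) (lam : Pt d → ℝ), (Function.support lam).Finite →
      ∑' y : Pt d, ∑ ν, P3 μ ν x y 0 * grad lam ν y = 0)
    (μ κ' : Fin d) (x : Pt d) : ∑' y : Pt d, P3 μ κ' x y 0 = 0 := by
  have hC := hD.nonneg μ κ'
  -- the limit of the WT identities for λ_R is the marginal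
  have hlim : Tendsto (fun R : ℕ => ∑' y : Pt d, ∑ ν, P3 μ ν x y 0 * grad (lamBox κ' R) ν y) atTop
      (𝓝 (∑' y : Pt d, ∑ ν, P3 μ ν x y 0 * (if ν = κ' then (1:ℝ) else 0))) := by
    refine tendsto_tsum_of_dominated_convergence
      (bound := fun y => ∑ _ν : Fin d, (C * wt κ x * 3) * (wt κ y * pw 1 y)) ?_ ?_ ?_
    · have hs : Summable fun y : Pt d => (C * wt κ x * 3) * (wt κ y * pw 1 y) :=
        (summable_wt_pw (d := d) hκ 1).mul_left (C * wt κ x * 3)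
      exact summable_sum fun ν _ => hs
    · intro y
      refine tendsto_finsetSum _ fun ν _ => ?_
      have hev : (fun _ : ℕ => (if ν = κ' then (1:ℝ) else 0)) =ᶠ[atTop]
          fun R : ℕ => grad (lamBox κ' R) ν y :=
        Filter.EventuallyEq.symm (grad_lamBox_eventually κ' ν y)
      exact Tendsto.const_mul _ (tendsto_const_nhds.congr' hev)
    · refine Filter.Eventually.of_forall fun R y => ?_
      rw [Real.norm_eq_abs]
      refine (Finset.abs_sum_le_sum_abs _ _).trans (Finset.sum_le_sum fun ν _ => ?_)
      rw [abs_mul]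
      have h1 := hD μ ν x y 0
      rw [sub_zero, sub_zero] at h1
      have hC' := hD.nonneg μ ν
      calc |P3 μ ν x y 0| * |grad (lamBox κ' R) ν y| ≤ (C * wt κ x * wt κ y) * (3 * pw 1 y) :=
            mul_le_mul h1 (abs_grad_lamBox_le κ' ν R y) (abs_nonneg _)
              (mul_nonneg (mul_nonneg hC' (wt_pos κ x).le) (wt_pos κ y).le)
        _ = (C * wt κ x * 3) * (wt κ y * pw 1 y) := by ring
  have hzero : (fun R : ℕ => ∑' y : Pt d, ∑ ν, P3 μ ν x y 0 * grad (lamBox κ' R) ν y) = fun _ => 0 := by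
    funext R
    exact hWT μ x (lamBox κ' R) (lamBox_support_finite κ' R)
  rw [hzero] at hlim
  have hδ : ∀ y : Pt d, (∑ ν, P3 μ ν x y 0 * (if ν = κ' then (1:ℝ) else 0)) = P3 μ κ' x y 0 := by
    intro y
    simp [mul_ite]
  rw [tsum_congr hδ] at hlim
  exact (tendsto_nhds_unique tendsto_const_nhds hlim).symm

/-- Decay (3.48) is symmetric under the exchange of the two slots. [cite: Balaban1988Convergent, (3.48) p.280] -/
theorem decay3_swap (hD : Decay3 P3 C κ) : Decay3 (fun μ ν x y z => P3 ν μ y x z) C κ := by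
  intro μ ν x y z
  have h := hD ν μ y x z
  calc |P3 ν μ y x z| ≤ C * wt κ (y - z) * wt κ (x - z) := h
    _ = C * wt κ (x - z) * wt κ (y - z) := by ring

/-- **The `x`-marginal identity** used in (3.62), from (I.4.15)₁ with the two slots exchanged (`⟨(δ²/δB²)𝐄(1), ∂λ, δ_{(ν,y)}⟩
= 0` for gauge functions of finite support): `Σ_x Π_{μν}(x, y, 0) = 0`. [cite: Balaban1988Convergent, (3.62) p.282] -/
theorem marginal_x_eq_zero (hD : Decay3 P3 C κ) (hκ : 0 < κ)
    (hWT' : ∀ (ν : Fin d) (y : Pt d) (lam : Pt d → ℝ), (Function.support lam).Finite →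
      ∑' x : Pt d, ∑ μ, P3 μ ν x y 0 * grad lam μ x = 0)
    (μ ν : Fin d) (y : Pt d) : ∑' x : Pt d, P3 μ ν x y 0 = 0 :=
  marginal_y_eq_zero (P3 := fun μ ν x y z => P3 ν μ y x z) (decay3_swap hD) hκ
    (fun ν y lam hlam => hWT' ν y lam hlam) ν μ y

/-- For a SYMMETRIC second-derivative kernel (`Π_{μν}(x, y, 0) = Π_{νμ}(y, x, 0)`) the one identity (I.4.15)₁ gives both
marginals. [cite: Balaban1988Convergent, (3.62) p.282] -/
theorem marginal_x_eq_zero_of_symm (hD : Decay3 P3 C κ) (hκ : 0 < κ)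
    (hsym : ∀ μ ν x y, P3 μ ν x y 0 = P3 ν μ y x 0)
    (hWT : ∀ (μ : Fin d) (x : Pt d) (lam : Pt d → ℝ), (Function.support lam).Finite →
      ∑' y : Pt d, ∑ ν, P3 μ ν x y 0 * grad lam ν y = 0)
    (μ ν : Fin d) (y : Pt d) : ∑' x : Pt d, P3 μ ν x y 0 = 0 := by
  have h := marginal_y_eq_zero hD hκ hWT ν μ y
  rw [← h]
  exact tsum_congr fun x => hsym μ ν x y

/-! ## §3. (3.62)–(3.64) with the marginal hypotheses discharged to (I.4.15)₁ -/

/-- **(3.62), first equality**, with *"(I.4.15) again"* now an explicit input instead of the marginal hypotheses: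
`β′_j = −½ Σ_{x,y} Π_{22}(x, y, 0)(x₁ − y₁)²`. [cite: Balaban1988Convergent, (3.62) p.282] -/
theorem eq362a_of_WT (hD : Decay3 P3 C κ) (hκ : 0 < κ)
    (hWT : ∀ (μ : Fin d) (x : Pt d) (lam : Pt d → ℝ), (Function.support lam).Finite →
      ∑' y : Pt d, ∑ ν, P3 μ ν x y 0 * grad lam ν y = 0)
    (hWT' : ∀ (ν : Fin d) (y : Pt d) (lam : Pt d → ℝ), (Function.support lam).Finite →
      ∑' x : Pt d, ∑ μ, P3 μ ν x y 0 * grad lam μ x = 0)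
    (one two : Fin d) :
    betaPrime P3 one two
      = -(1/2 : ℝ) * ∑' q : Pt d × Pt d, P3 two two q.1 q.2 0 * ((q.1 one : ℝ) - (q.2 one : ℝ)) ^ 2 :=
  eq362a hD hκ one two (fun y => marginal_x_eq_zero hD hκ hWT' two two y)
    (fun x => marginal_y_eq_zero hD hκ hWT two two x)

/-- **(3.61)–(3.64) for the summed kernel, inputs as printed**: translation invariance, the decay (3.48), the Ward–Takahashi
identity (I.4.15)₁ (both slots, gauge functions of finite support) and [I]'s second-order Taylor data of the summed kernel
`Π_{μν}(v) = Σ_zΠ_{μν}(v, 0, z)` ((I.5.16)/(I.5.37)) give `β′_j = β` — `B14.Eq363SummedKernel.eq364_summed` with `hWx`, `hWy`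
DISCHARGED. [cite: Balaban1988Convergent, (3.61)–(3.64) pp.282–283] -/
theorem eq364_of_WT (hT : TranslInv P3) (hD : Decay3 P3 C κ) (hκ : 0 < κ) {one two : Fin d} (h12 : two ≠ one)
    (hWT : ∀ (μ : Fin d) (x : Pt d) (lam : Pt d → ℝ), (Function.support lam).Finite →
      ∑' y : Pt d, ∑ ν, P3 μ ν x y 0 * grad lam ν y = 0)
    (hWT' : ∀ (ν : Fin d) (y : Pt d) (lam : Pt d → ℝ), (Function.support lam).Finite →
      ∑' x : Pt d, ∑ μ, P3 μ ν x y 0 * grad lam μ x = 0)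
    {β : ℝ} (hTD : ∀ μ ν, B12Rep537.TaylorData3 (β : ℂ) μ ν (B12Form543.ofRealK (sumKernel P3) μ ν)) :
    betaPrime P3 one two = β :=
  eq364_summed hT hD hκ h12 (fun y => marginal_x_eq_zero hD hκ hWT' two two y)
    (fun x => marginal_y_eq_zero hD hκ hWT two two x) hTD

end Literature.MathematicalPhysics.QuantumFieldTheory.Balaban1983to89.B14.Eq362Marginals
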